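import Summits.HodgeConjecture.HodgeConjecture.Cruxes.BlochSeedDiscOne.LeggedFloor

/-!
line stmt-HodgeConjecture-18881 Cruxes/BlochSeedDiscOne/Lines/birth.lean 814a6a70c14e831a stub_rung_pad4_seedAt

# QuadrantSlide — the off-axis shape of RULE-D null steps (strengthen g21, companion to `AxisSPlus.lean`)

`AxisSPlus.lean` closes the S⁺ sentence of record on AXIS supports and reduces the door of record to designs with an off-axis
support letter (`AxisSPlus.sPlus_iff_offAxis`).  Its supplier calculus rests on the axis slide lemma (weak arrows between axis
letters run along a ray).  This file records what survives OFF the axes, at EVERY height, for the NULL steps that RULE D uses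
(`LeggedFloor.NullStep ℓ ℓ'`: `ℓ.a < ℓ'.a ∧ |β' − β|² = (a' − a)²`):

* `quadrant_slide` — if `ℓ, ℓ'` lie on one alphabet and in ONE CLOSED QUADRANT (`0 ≤ x·x'`, `0 ≤ y·y'`), a null step `ℓ → ℓ'` is
  AXIS-PARALLEL and lengthens one coordinate: `x = x' ∧ |y'| < |y|` or `y = y' ∧ |x'| < |x|`.
* `nullStep_cross` — a genuinely diagonal null step (`x ≠ x'`, `y ≠ y'`; a PYTHAGOREAN step `(p, q, Δ)`, `pq ≠ 0`) CROSSES AN AXIS: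
  `x·x' < 0 ∨ y·y' < 0`.
* `two_mul_abs_le_of_cross` — the crossed coordinate of the upper letter is small: `x·x' < 0 ⇒ 2|x'| ≤ |p| + |q| − Δ` (and the `y` version).
* `cross_coord_le_two` — on an alphabet of height `h ≤ 14` the only Pythagorean steps are `(3,4,5)`, `(6,8,10)`, `(5,12,13)` up to signs and
  order (`slack_le_four`, a bounded `decide`), so a crossed coordinate has absolute value `≤ 2`.
Cell level: `supplies_slot_shape` — in a ONE-QUADRANT ROOM every RULE-D supplier step is, slot by slot, equality or an axis-parallel extension.

Use (next seat): off the axes RULE D stays rigid inside one closed quadrant and away from the axes (letters with `min(|x|,|y|) ≥ 3` at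
`h ≤ 14` are never crossed into); the missing ingredient for an off-axis N-mass law is a «many classes» engine replacing the torus law.
HONEST LABEL: letter-model statements only; nothing here is proved toward HC ∕ HC_CM ∕ HC_AV ∕ №4 ∕ 26512 ∕ 18881 ∕ H2.  No `sorry`,
no `native_decide`, no new axiom, no instance ∕ notation.
-/

set_option linter.dupNamespace false
set_option autoImplicit false

namespace Summit.HodgeConjecture.HodgeConjecture.Cruxes.BlochSeedDiscOne.QuadrantSlide

open Summit.HodgeConjecture.HodgeConjecture.Cruxes.BlochSeedDiscOne.DepthBoundA4
open Summit.HodgeConjecture.HodgeConjecture.Cruxes.BlochSeedDiscOne.LeggedFloor (NullStep Supplies)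

/-! ## §1 Letter level -/

/-- same closed half-line: `0 ≤ a·b ⇒ (a − b)² = (|a| − |b|)²`. -/
theorem sq_sub_eq_sq_abs_sub {a b : ℤ} (hab : 0 ≤ a * b) : (a - b) ^ 2 = (|a| - |b|) ^ 2 := by
  have h1 : |a| * |b| = a * b := by rw [← abs_mul]; exact abs_of_nonneg hab
  have ha : |a| ^ 2 = a ^ 2 := sq_abs a
  have hb : |b| ^ 2 = b ^ 2 := sq_abs b
  nlinarith [h1, ha, hb]

/-- same sign and same absolute value ⇒ equal. -/
theorem eq_of_abs_eq_of_mul_nonneg {a b : ℤ} (hab : 0 ≤ a * b) (h : |a| = |b|) : a = b := by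
  rcases abs_eq_abs.mp h with h' | h'
  · exact h'
  · subst h'
    have : b * b ≤ 0 := by nlinarith [hab]
    have hb : b = 0 := by nlinarith [mul_self_nonneg b]
    simp [hb]

/-- the height bookkeeping of a null step on one alphabet: `Δ = a' − a = (|x| − |x'|) + (|y| − |y'|) > 0`. -/
theorem delta_eq {h : ℤ} {ℓ ℓ' : Letter} (hℓ : ℓ.OnAlphabet h) (hℓ' : ℓ'.OnAlphabet h) :
    ℓ'.a - ℓ.a = (|ℓ.x| - |ℓ'.x|) + (|ℓ.y| - |ℓ'.y|) := by
  have e1 := hℓ.1; have e2 := hℓ'.1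
  unfold Letter.height at e1 e2
  linarith

/-- **QUADRANT SLIDE LEMMA** (every height): a null step between letters of one closed quadrant is axis-parallel and lengthens one coordinate. -/
theorem quadrant_slide {h : ℤ} {ℓ ℓ' : Letter} (hℓ : ℓ.OnAlphabet h) (hℓ' : ℓ'.OnAlphabet h)
    (hx : 0 ≤ ℓ.x * ℓ'.x) (hy : 0 ≤ ℓ.y * ℓ'.y) (hs : NullStep ℓ ℓ') :
    (ℓ.x = ℓ'.x ∧ |ℓ'.y| < |ℓ.y|) ∨ (ℓ.y = ℓ'.y ∧ |ℓ'.x| < |ℓ.x|) := by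
  obtain ⟨hlt, heq⟩ := hs
  have hΔ := delta_eq hℓ hℓ'
  have hP : (ℓ'.x - ℓ.x) ^ 2 = (|ℓ.x| - |ℓ'.x|) ^ 2 := by
    rw [show (ℓ'.x - ℓ.x) ^ 2 = (ℓ.x - ℓ'.x) ^ 2 by ring]; exact sq_sub_eq_sq_abs_sub hx
  have hQ : (ℓ'.y - ℓ.y) ^ 2 = (|ℓ.y| - |ℓ'.y|) ^ 2 := by
    rw [show (ℓ'.y - ℓ.y) ^ 2 = (ℓ.y - ℓ'.y) ^ 2 by ring]; exact sq_sub_eq_sq_abs_sub hy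
  set P := |ℓ.x| - |ℓ'.x| with hPdef
  set Q := |ℓ.y| - |ℓ'.y| with hQdef
  have hPQ : P * Q = 0 := by
    have : P ^ 2 + Q ^ 2 = (P + Q) ^ 2 := by rw [← hP, ← hQ, heq, hΔ]
    nlinarith [this]
  rcases mul_eq_zero.mp hPQ with hP0 | hQ0
  · left
    refine ⟨eq_of_abs_eq_of_mul_nonneg hx (by linarith), ?_⟩
    have : 0 < Q := by linarith
    linarith
  · right
    refine ⟨eq_of_abs_eq_of_mul_nonneg hy (by linarith), ?_⟩
    have : 0 < P := by linarith
    linarith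

/-- a diagonal (Pythagorean) null step crosses an axis. -/
theorem nullStep_cross {h : ℤ} {ℓ ℓ' : Letter} (hℓ : ℓ.OnAlphabet h) (hℓ' : ℓ'.OnAlphabet h) (hs : NullStep ℓ ℓ')
    (hp : ℓ.x ≠ ℓ'.x) (hq : ℓ.y ≠ ℓ'.y) : ℓ.x * ℓ'.x < 0 ∨ ℓ.y * ℓ'.y < 0 := by
  rcases lt_or_ge (ℓ.x * ℓ'.x) 0 with hx | hx
  · exact Or.inl hx
  rcases lt_or_ge (ℓ.y * ℓ'.y) 0 with hy | hy
  · exact Or.inr hy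
  rcases quadrant_slide hℓ hℓ' hx hy hs with ⟨h1, -⟩ | ⟨h1, -⟩
  · exact absurd h1 hp
  · exact absurd h1 hq

/-- in one closed quadrant a null step never changes both coordinates (contrapositive form used at cell level). -/
theorem nullStep_axisParallel {h : ℤ} {ℓ ℓ' : Letter} (hℓ : ℓ.OnAlphabet h) (hℓ' : ℓ'.OnAlphabet h)
    (hx : 0 ≤ ℓ.x * ℓ'.x) (hy : 0 ≤ ℓ.y * ℓ'.y) (hs : NullStep ℓ ℓ') : ℓ.x = ℓ'.x ∨ ℓ.y = ℓ'.y := by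
  rcases quadrant_slide hℓ hℓ' hx hy hs with ⟨h1, -⟩ | ⟨h1, -⟩
  · exact Or.inl h1
  · exact Or.inr h1

/-- opposite signs: `|a − b| = |a| + |b|`, stated as the inequality we need: `|a| − |b| = |a − b| − 2|b|`. -/
theorem abs_sub_abs_of_mul_neg {a b : ℤ} (hab : a * b < 0) : |a| - |b| = |a - b| - 2 * |b| := by
  rcases lt_trichotomy a 0 with ha | ha | ha
  · have hb : 0 < b := by nlinarith
    rw [abs_of_neg ha, abs_of_pos hb, abs_of_neg (by linarith : a - b < 0)]; ring
  · subst ha; simp at hab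
  · have hb : b < 0 := by nlinarith
    rw [abs_of_pos ha, abs_of_neg hb, abs_of_pos (by linarith : 0 < a - b)]; ring

/-- always: `|a| − |b| ≤ |a − b|`. -/
theorem abs_sub_abs_le (a b : ℤ) : |a| - |b| ≤ |a - b| := abs_sub_abs_le_abs_sub a b

/-- the crossed coordinate of the UPPER letter is small: `x·x' < 0 ⇒ 2|x'| ≤ |p| + |q| − Δ`, `p = x − x'`, `q = y − y'`, `Δ = a' − a`. -/
theorem two_mul_abs_le_of_cross_x {h : ℤ} {ℓ ℓ' : Letter} (hℓ : ℓ.OnAlphabet h) (hℓ' : ℓ'.OnAlphabet h)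
    (hx : ℓ.x * ℓ'.x < 0) : 2 * |ℓ'.x| ≤ |ℓ.x - ℓ'.x| + |ℓ.y - ℓ'.y| - (ℓ'.a - ℓ.a) := by
  have hΔ := delta_eq hℓ hℓ'
  have h1 := abs_sub_abs_of_mul_neg hx
  have h2 := abs_sub_abs_le ℓ.y ℓ'.y
  linarith

/-- the `y` version. -/
theorem two_mul_abs_le_of_cross_y {h : ℤ} {ℓ ℓ' : Letter} (hℓ : ℓ.OnAlphabet h) (hℓ' : ℓ'.OnAlphabet h)
    (hy : ℓ.y * ℓ'.y < 0) : 2 * |ℓ'.y| ≤ |ℓ.x - ℓ'.x| + |ℓ.y - ℓ'.y| - (ℓ'.a - ℓ.a) := by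
  have hΔ := delta_eq hℓ hℓ'
  have h1 := abs_sub_abs_of_mul_neg hy
  have h2 := abs_sub_abs_le ℓ.x ℓ'.x
  linarith

/-! ## §2 The Pythagorean steps of a height-`≤ 14` alphabet -/

/-- bounded fact: an integer Pythagorean triple `p² + q² = Δ²` with `pq ≠ 0` and `0 < Δ ≤ 14` has slack `|p| + |q| − Δ ≤ 4`
(the triples are `(3,4,5)`, `(6,8,10)`, `(5,12,13)` up to signs and order; slacks `2, 4, 4`). -/
theorem slack_le_four_bdd :
    ∀ Δ ∈ Finset.Icc (1 : ℤ) 14, ∀ p ∈ Finset.Icc (-14 : ℤ) 14, ∀ q ∈ Finset.Icc (-14 : ℤ) 14,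
      p ^ 2 + q ^ 2 = Δ ^ 2 → p ≠ 0 → q ≠ 0 → |p| + |q| - Δ ≤ 4 := by
  decide +kernel

theorem slack_le_four {p q Δ : ℤ} (hΔ0 : 0 < Δ) (hΔ : Δ ≤ 14) (hpy : p ^ 2 + q ^ 2 = Δ ^ 2) (hp : p ≠ 0) (hq : q ≠ 0) :
    |p| + |q| - Δ ≤ 4 := by
  have hpa : |p| ≤ Δ := by nlinarith [sq_abs p, abs_nonneg p, sq_nonneg q]
  have hqa : |q| ≤ Δ := by nlinarith [sq_abs q, abs_nonneg q, sq_nonneg p]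
  have hpI : p ∈ Finset.Icc (-14 : ℤ) 14 := by
    rw [Finset.mem_Icc]; constructor <;> linarith [abs_le.mp (le_trans hpa hΔ) |>.1, abs_le.mp (le_trans hpa hΔ) |>.2]
  have hqI : q ∈ Finset.Icc (-14 : ℤ) 14 := by
    rw [Finset.mem_Icc]; constructor <;> linarith [abs_le.mp (le_trans hqa hΔ) |>.1, abs_le.mp (le_trans hqa hΔ) |>.2]
  have hΔI : Δ ∈ Finset.Icc (1 : ℤ) 14 := by rw [Finset.mem_Icc]; constructor <;> linarith
  exact slack_le_four_bdd Δ hΔI p hpI q hqI hpy hp hq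

/-- the null-step equation in the `(p, q, Δ)` variables of this file. -/
theorem nullStep_pyth {ℓ ℓ' : Letter} (hs : NullStep ℓ ℓ') :
    (ℓ.x - ℓ'.x) ^ 2 + (ℓ.y - ℓ'.y) ^ 2 = (ℓ'.a - ℓ.a) ^ 2 := by
  have := hs.2; nlinarith [this]

/-- on one alphabet of height `h`, `Δ = a' − a ≤ h`. -/
theorem delta_le {h : ℤ} {ℓ ℓ' : Letter} (hℓ : ℓ.OnAlphabet h) (hℓ' : ℓ'.OnAlphabet h) : ℓ'.a - ℓ.a ≤ h := by
  have e2 := hℓ'.1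
  unfold Letter.height at e2
  linarith [hℓ.2, abs_nonneg ℓ'.x, abs_nonneg ℓ'.y]

/-- **crossed coordinates are small** (`h ≤ 14`): a null step `ℓ → ℓ'` with `x·x' < 0` has `|x'| ≤ 2`. -/
theorem cross_coord_le_two_x {h : ℤ} (hh : h ≤ 14) {ℓ ℓ' : Letter} (hℓ : ℓ.OnAlphabet h) (hℓ' : ℓ'.OnAlphabet h)
    (hs : NullStep ℓ ℓ') (hx : ℓ.x * ℓ'.x < 0) : |ℓ'.x| ≤ 2 := by
  have h2 := two_mul_abs_le_of_cross_x hℓ hℓ' hx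
  have hpy := nullStep_pyth hs
  have hΔ0 : 0 < ℓ'.a - ℓ.a := by linarith [hs.1]
  have hΔ : ℓ'.a - ℓ.a ≤ 14 := le_trans (delta_le hℓ hℓ') hh
  have hp : ℓ.x - ℓ'.x ≠ 0 := by
    intro h0
    have : ℓ.x = ℓ'.x := by linarith
    rw [this] at hx
    nlinarith [mul_self_nonneg ℓ'.x]
  by_cases hq : ℓ.y - ℓ'.y = 0
  · -- then `|p| = Δ` and the slack is `0`
    have hq' : |ℓ.y - ℓ'.y| = 0 := by rw [hq]; simp
    have hpΔ : |ℓ.x - ℓ'.x| = ℓ'.a - ℓ.a := by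
      have hsq : (ℓ.x - ℓ'.x) ^ 2 = (ℓ'.a - ℓ.a) ^ 2 := by rw [hq] at hpy; simpa using hpy
      have h3 : |ℓ.x - ℓ'.x| = |ℓ'.a - ℓ.a| := by
        exact abs_eq_abs.mpr (by
          have h4 : (ℓ.x - ℓ'.x - (ℓ'.a - ℓ.a)) * (ℓ.x - ℓ'.x + (ℓ'.a - ℓ.a)) = 0 := by nlinarith [hsq]
          rcases mul_eq_zero.mp h4 with h5 | h5
          · exact Or.inl (by linarith)
          · exact Or.inr (by linarith))
      rw [h3, abs_of_pos hΔ0]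
    have : 2 * |ℓ'.x| ≤ 0 := by linarith
    linarith [abs_nonneg ℓ'.x]
  · have := slack_le_four hΔ0 hΔ hpy hp hq
    linarith

/-- the `y` version. -/
theorem cross_coord_le_two_y {h : ℤ} (hh : h ≤ 14) {ℓ ℓ' : Letter} (hℓ : ℓ.OnAlphabet h) (hℓ' : ℓ'.OnAlphabet h)
    (hs : NullStep ℓ ℓ') (hy : ℓ.y * ℓ'.y < 0) : |ℓ'.y| ≤ 2 := by
  -- swap the coordinates and reuse the `x` version
  have hsw : NullStep (⟨ℓ.a, ℓ.y, ℓ.x⟩ : Letter) ⟨ℓ'.a, ℓ'.y, ℓ'.x⟩ := by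
    obtain ⟨h1, h2⟩ := hs; exact ⟨h1, by simp only at h2 ⊢; linarith⟩
  have hℓs : (⟨ℓ.a, ℓ.y, ℓ.x⟩ : Letter).OnAlphabet h := by
    obtain ⟨e, n⟩ := hℓ; refine ⟨?_, n⟩; unfold Letter.height at e ⊢; simp only at e ⊢; linarith
  have hℓs' : (⟨ℓ'.a, ℓ'.y, ℓ'.x⟩ : Letter).OnAlphabet h := by
    obtain ⟨e, n⟩ := hℓ'; refine ⟨?_, n⟩; unfold Letter.height at e ⊢; simp only at e ⊢; linarith
  exact cross_coord_le_two_x hh hℓs hℓs' hsw (by simpa using hy)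

/-- summary at `h ≤ 14`: a null step into a letter both of whose coordinates have absolute value `≥ 3` is axis-parallel
(the deep interior of each quadrant is never crossed into). -/
theorem nullStep_into_deep {h : ℤ} (hh : h ≤ 14) {ℓ ℓ' : Letter} (hℓ : ℓ.OnAlphabet h) (hℓ' : ℓ'.OnAlphabet h)
    (hs : NullStep ℓ ℓ') (h3x : 3 ≤ |ℓ'.x|) (h3y : 3 ≤ |ℓ'.y|) :
    (ℓ.x = ℓ'.x ∧ |ℓ'.y| < |ℓ.y|) ∨ (ℓ.y = ℓ'.y ∧ |ℓ'.x| < |ℓ.x|) := by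
  have hx : 0 ≤ ℓ.x * ℓ'.x := by
    rcases lt_or_ge (ℓ.x * ℓ'.x) 0 with hc | hc
    · have := cross_coord_le_two_x hh hℓ hℓ' hs hc; linarith
    · exact hc
  have hy : 0 ≤ ℓ.y * ℓ'.y := by
    rcases lt_or_ge (ℓ.y * ℓ'.y) 0 with hc | hc
    · have := cross_coord_le_two_y hh hℓ hℓ' hs hc; linarith
    · exact hc
  exact quadrant_slide hℓ hℓ' hx hy hs

/-! ## §3 Cell level: RULE-D supplier steps in a one-quadrant room -/

/-- a ONE-QUADRANT ROOM, slot by slot: any two support letters in the same slot lie in one closed quadrant. -/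
def SlotQuadrantRoom (D : Design) : Prop :=
  ∀ c ∈ D.suppN ++ D.suppP, ∀ c' ∈ D.suppN ++ D.suppP, ∀ f : Fin 4, 0 ≤ (c f).x * (c' f).x ∧ 0 ≤ (c f).y * (c' f).y

/-- in a one-quadrant room on one alphabet, a RULE-D supplier pair `Supplies x y g j` (`x ∈ suppP`, `y ∈ suppN`) is, on EVERY slot, equality or an
axis-parallel extension of one coordinate of `y`'s letter (the off-axis form of the axis slide lemma used in `AxisSPlus.supplier_inCl`). -/
theorem supplies_slot_shape {h : ℤ} {D : Design} (hD : D.OnAlphabet h) (hR : SlotQuadrantRoom D)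
    {x y : Cell} (hx : x ∈ D.suppP) (hy : y ∈ D.suppN) {g j : Fin 4} (hS : Supplies x y g j) (f : Fin 4) :
    x f = y f ∨ ((x f).x = (y f).x ∧ |(y f).y| < |(x f).y|) ∨ ((x f).y = (y f).y ∧ |(y f).x| < |(x f).x|) := by
  have hxs : x ∈ D.suppN ++ D.suppP := List.mem_append_right _ hx
  have hys : y ∈ D.suppN ++ D.suppP := List.mem_append_left _ hy
  have step : ∀ f', (x f' = y f' ∨ NullStep (x f') (y f')) →
      x f' = y f' ∨ ((x f').x = (y f').x ∧ |(y f').y| < |(x f').y|) ∨ ((x f').y = (y f').y ∧ |(y f').x| < |(x f').x|) := by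
    intro f' hf'
    rcases hf' with he | hn
    · exact Or.inl he
    · exact Or.inr (quadrant_slide (hD x hxs f') (hD y hys f') (hR x hxs y hys f').1 (hR x hxs y hys f').2 hn)
  obtain ⟨hoff, hg, hj⟩ := hS
  by_cases hfg : f = g
  · subst hfg; exact step f hg
  by_cases hfj : f = j
  · subst hfj; exact step f hj
  exact Or.inl (hoff f hfg hfj)

end Summit.HodgeConjecture.HodgeConjecture.Cruxes.BlochSeedDiscOne.QuadrantSlide
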